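/-
Copyright (c) 2026. All rights reserved.
Released under Apache 2.0 license as described in the file LICENSE.
Authors: abc-iut cell, seat abc-iut-L4-t14 (wave 2).
-/
import Literature.AnabelianGeometry.AbsoluteAnabelian.HolomorphicCoresDeckProofs
import HarnessLib

/-!
# [AbsTopIII] Cor 2.4: the finite-type hypothesis is inhabited — proof

Proof-only companion of `HolomorphicCores.lean` ([MochizukiAbsTopIII2015], Cor 2.4 p.54 of the kurims
manuscript `paper:url-5493eb38cbb7`): the hypothesis `IsOfFiniteType X` ("`X` is biholomorphic to a
compact Riemann surface minus finitely many points") carried by the named facts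
`DeckGroupInAutIdComponent` / `HyperbolicCoreOrbispace` is NON-VACUOUS: every compact connected Riemann
surface is of finite type (witness: `X̄ := X`, `S := ∅`, the tautological biholomorphism `X ≅ X ∖ ∅`).
No definitions; nothing here bears on [IUTchIII] Cor. 3.12.
-/

noncomputable section

open scoped Manifold ContDiff Topology
open TopologicalSpace Set

namespace Literature.AnabelianGeometry.AbsoluteAnabelian

/-- **A compact connected Riemann surface is of finite type** (`X̄ = X`, `S = ∅`): the hypothesis
`IsOfFiniteType` of Cor 2.4 (b)/(c) as typed is inhabited by its intended first examples.
[cite: MochizukiAbsTopIII2015, Corollary 2.4 p.54] -/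
theorem isOfFiniteType_of_compact (X : Type) [TopologicalSpace X] [T2Space X] [CompactSpace X]
    [ConnectedSpace X] [ChartedSpace ℂ X] [IsManifold 𝓘(ℂ, ℂ) ω X] : IsOfFiniteType X := by
  classical
  set O : Opens X := ⟨(((∅ : Finset X) : Set X))ᶜ, (∅ : Finset X).finite_toSet.isClosed.isOpen_compl⟩
    with hO
  have hmem : ∀ x : X, x ∈ O := by
    intro x
    change x ∈ (((∅ : Finset X) : Set X))ᶜ
    rw [Finset.coe_empty, Set.compl_empty]
    exact Set.mem_univ x
  set e : X ≃ₜ O :=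
    { toFun := fun x => ⟨x, hmem x⟩
      invFun := fun y => y.1
      left_inv := fun _ => rfl
      right_inv := fun _ => rfl
      continuous_toFun := continuous_id.subtype_mk _
      continuous_invFun := continuous_subtype_val } with he
  have hol : MDifferentiable 𝓘(ℂ, ℂ) 𝓘(ℂ, ℂ) e := by
    intro x
    rw [← mdifferentiableAt_subtypeVal_comp_iff]
    exact mdifferentiableAt_id
  have hol' : MDifferentiable 𝓘(ℂ, ℂ) 𝓘(ℂ, ℂ) e.symm := by
    intro y
    have : ⇑e.symm = fun y => (id : X → X) y.1 := rfl
    rw [this, mdifferentiableAt_subtype_iff]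
    exact mdifferentiableAt_id
  exact ⟨{ Xc := X, S := ∅, e := e, hol := hol, hol_symm := hol' }⟩

end Literature.AnabelianGeometry.AbsoluteAnabelian

end
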